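import Mathlib
import Summits.Ventures.HodgeRepro2.T5Semilinear

/-!
# T5ConjugateEigenlines — complex conjugation exchanges the `σ`- and `σ̄`-eigenlines

Kernel form of the [P] parenthesis of `route/T5-SUPPORT-p1.md` §S1.2 (Tier-5 support for N0 / N1, seat p1):
«the `τ̄₁`-eigenline of `A_i` is the complex conjugate of its `τ₁`-eigenline, since the `F`-action is defined
over `ℚ` and complex conjugation on `H¹(A_i, ℂ)` exchanges the `σ`- and `σ̄`-eigenlines».

Model: `H¹(A_i, ℂ) = H¹(A_i, ℚ) ⊗_ℚ ℂ` is `ℂ ⊗[ℚ] V` for a `ℚ`-module `V`; the `F`-action is a family of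
`ℚ`-linear maps `T a : V →ₗ[ℚ] V` (`a ∈ F`), acting on the complexification by base change; complex
conjugation is p2's `T5Semilinear.galAct` for the `ℚ`-algebra automorphism `conjQ` of `ℂ` (imported, not
re-proved). For an eigencharacter `θ : ι → ℂ` (for `F` a field, `θ = σ : F →+* ℂ` an embedding) the joint
eigenspace `jointEigenspace T θ = ⨅ a, eigenspace (T a ⊗ 1) (θ a)` is carried by `conjAct` ONTO the joint
eigenspace of `\overline{θ}`, and the two have the same `ℂ`-dimension — in particular an eigenLINE goes to an
eigenLINE (`finrank_jointEigenspace_conj`, `finrank_eq_one_iff_conj`).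

Not formalised (honest scope): cohomology, the comparison `H¹_B(A, ℂ) = H¹_B(A, ℚ) ⊗ ℂ`, the decomposition
`V_ℂ = ⊕_σ E_σ` for a CM field `F` (`F ⊗ ℂ ≅ ℂ^{Hom(F,ℂ)}`), Hodge types.
-/

namespace Summit.Ventures.HodgeRepro2.T5ConjugateEigenlines

open TensorProduct T5Semilinear

/-- Complex conjugation as a `ℚ`-algebra automorphism of `ℂ`. -/
noncomputable def conjQ : ℂ ≃ₐ[ℚ] ℂ :=
  AlgEquiv.ofRingEquiv (f := starRingAut) (fun q => by simp)

/-- `conjQ` is complex conjugation. -/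
@[simp] theorem conjQ_apply (z : ℂ) : conjQ z = (starRingEnd ℂ) z := rfl

/-- `conjQ` is an involution. -/
theorem conjQ_symm : conjQ.symm = conjQ := by
  ext z
  rw [AlgEquiv.symm_apply_eq, conjQ_apply, conjQ_apply, Complex.conj_conj]

variable {V : Type*} [AddCommGroup V] [Module ℚ V]

/-- Complex conjugation on the complexification `ℂ ⊗[ℚ] V` (conjugation of the coefficients):
p2's `galAct` for `conjQ`. -/
noncomputable def conjAct : ℂ ⊗[ℚ] V ≃ₗ[ℚ] ℂ ⊗[ℚ] V := galAct conjQ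

/-- On pure tensors `conjAct` conjugates the coefficient. -/
theorem conjAct_tmul (z : ℂ) (v : V) : conjAct (z ⊗ₜ[ℚ] v) = (starRingEnd ℂ) z ⊗ₜ[ℚ] v :=
  galAct_tmul conjQ z v

/-- `conjAct` is conjugate-linear. -/
theorem conjAct_smul (c : ℂ) (x : ℂ ⊗[ℚ] V) : conjAct (c • x) = (starRingEnd ℂ) c • conjAct x :=
  galAct_smul conjQ c x

/-- `conjAct` is real-linear. -/
theorem conjAct_real_smul (r : ℝ) (x : ℂ ⊗[ℚ] V) : conjAct ((r : ℂ) • x) = (r : ℂ) • conjAct x := by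
  rw [conjAct_smul, Complex.conj_ofReal]

/-- `conjAct` is an involution. -/
theorem conjAct_conjAct (x : ℂ ⊗[ℚ] V) : conjAct (conjAct x) = x := by
  have h := galAct_symm_galAct conjQ x
  rwa [conjQ_symm] at h

/-- `conjAct` commutes with every base-changed `ℚ`-linear map («the `F`-action is defined over `ℚ`»). -/
theorem conjAct_baseChange (T : V →ₗ[ℚ] V) (x : ℂ ⊗[ℚ] V) :
    conjAct (T.baseChange ℂ x) = T.baseChange ℂ (conjAct x) :=
  galAct_baseChange conjQ T x

section Eigenspaces

variable {ι : Type*}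

/-- The joint eigenspace of the base-changed family `T` for the eigencharacter `θ`:
`⨅ i, eigenspace (T i ⊗ 1) (θ i)` (for `ι = F` a field and `θ = σ` an embedding, the `σ`-eigenspace of the
`F`-action on `V ⊗ ℂ`). -/
noncomputable def jointEigenspace (T : ι → V →ₗ[ℚ] V) (θ : ι → ℂ) : Submodule ℂ (ℂ ⊗[ℚ] V) :=
  ⨅ i, Module.End.eigenspace ((T i).baseChange ℂ) (θ i)

/-- Membership in the joint eigenspace. -/
theorem mem_jointEigenspace_iff (T : ι → V →ₗ[ℚ] V) (θ : ι → ℂ) (x : ℂ ⊗[ℚ] V) :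
    x ∈ jointEigenspace T θ ↔ ∀ i, (T i).baseChange ℂ x = θ i • x := by
  simp only [jointEigenspace, Submodule.mem_iInf, Module.End.mem_eigenspace_iff]

/-- The conjugate eigencharacter. -/
def conjChar (θ : ι → ℂ) : ι → ℂ := fun i => (starRingEnd ℂ) (θ i)

/-- Conjugating twice gives the character back. -/
@[simp] theorem conjChar_conjChar (θ : ι → ℂ) : conjChar (conjChar θ) = θ := by
  funext i
  simp [conjChar]

/-- `conjAct` carries the `θ`-eigenspace to the `\overline{θ}`-eigenspace, and conversely
(p2's `mem_iInf_eigenspace_galAct_iff` for `g = conjQ`). -/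
theorem conjAct_mem_jointEigenspace_iff (T : ι → V →ₗ[ℚ] V) (θ : ι → ℂ) (x : ℂ ⊗[ℚ] V) :
    conjAct x ∈ jointEigenspace T (conjChar θ) ↔ x ∈ jointEigenspace T θ :=
  mem_iInf_eigenspace_galAct_iff conjQ T θ x

/-- The image of the `θ`-eigenspace under `conjAct` is exactly the `\overline{θ}`-eigenspace
(«complex conjugation exchanges the `σ`- and `σ̄`-eigenlines»). -/
theorem conjAct_image_jointEigenspace (T : ι → V →ₗ[ℚ] V) (θ : ι → ℂ) :
    conjAct '' (jointEigenspace T θ : Set (ℂ ⊗[ℚ] V)) = jointEigenspace T (conjChar θ) := by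
  ext y
  constructor
  · rintro ⟨x, hx, rfl⟩
    exact (conjAct_mem_jointEigenspace_iff T θ x).2 hx
  · intro hy
    refine ⟨conjAct y, ?_, conjAct_conjAct y⟩
    have h := (conjAct_mem_jointEigenspace_iff T (conjChar θ) y).2 hy
    rwa [conjChar_conjChar] at h

/-- The conjugate-linear additive equivalence between the two joint eigenspaces. -/
noncomputable def conjEquiv (T : ι → V →ₗ[ℚ] V) (θ : ι → ℂ) :
    jointEigenspace T θ ≃+ jointEigenspace T (conjChar θ) where
  toFun x := ⟨conjAct x, (conjAct_mem_jointEigenspace_iff T θ x).2 x.2⟩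
  invFun y := ⟨conjAct y, by
    have h := (conjAct_mem_jointEigenspace_iff T (conjChar θ) y).2 y.2
    rwa [conjChar_conjChar] at h⟩
  left_inv x := by
    ext
    exact conjAct_conjAct (x : ℂ ⊗[ℚ] V)
  right_inv y := by
    ext
    exact conjAct_conjAct (y : ℂ ⊗[ℚ] V)
  map_add' x y := by
    ext
    exact map_add conjAct (x : ℂ ⊗[ℚ] V) (y : ℂ ⊗[ℚ] V)

/-- The equivalence is `conjAct` on the underlying vectors. -/
@[simp] theorem conjEquiv_apply_coe (T : ι → V →ₗ[ℚ] V) (θ : ι → ℂ) (x : jointEigenspace T θ) :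
    (conjEquiv T θ x : ℂ ⊗[ℚ] V) = conjAct x :=
  rfl

/-- The two joint eigenspaces have the same rank over `ℂ` (a conjugate-semilinear equivalence preserves
the dimension: Mathlib's `rank_eq_of_equiv_equiv`). -/
theorem rank_jointEigenspace_conj (T : ι → V →ₗ[ℚ] V) (θ : ι → ℂ) :
    Module.rank ℂ (jointEigenspace T (conjChar θ)) = Module.rank ℂ (jointEigenspace T θ) := by
  refine (rank_eq_of_equiv_equiv (fun z : ℂ => (starRingEnd ℂ) z) (conjEquiv T θ)
    (Function.Involutive.bijective Complex.conj_conj) ?_).symm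
  intro r m
  ext
  simp only [conjEquiv_apply_coe, Submodule.coe_smul]
  exact conjAct_smul r (m : ℂ ⊗[ℚ] V)

/-- The two joint eigenspaces have the same `ℂ`-dimension. -/
theorem finrank_jointEigenspace_conj (T : ι → V →ₗ[ℚ] V) (θ : ι → ℂ) :
    Module.finrank ℂ (jointEigenspace T (conjChar θ)) = Module.finrank ℂ (jointEigenspace T θ) := by
  simp only [Module.finrank, rank_jointEigenspace_conj]

/-- An eigenLINE for `θ` is an eigenLINE for `\overline{θ}`. -/
theorem finrank_eq_one_iff_conj (T : ι → V →ₗ[ℚ] V) (θ : ι → ℂ) :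
    Module.finrank ℂ (jointEigenspace T (conjChar θ)) = 1 ↔
      Module.finrank ℂ (jointEigenspace T θ) = 1 := by
  rw [finrank_jointEigenspace_conj]

end Eigenspaces

section CMField

variable {K : Type*} [Field K]

/-- For an embedding `σ : K →+* ℂ` of a field, the conjugate eigencharacter is the conjugate embedding
`σ̄ = NumberField.ComplexEmbedding.conjugate σ`. -/
theorem conjChar_embedding (σ : K →+* ℂ) :
    conjChar (σ : K → ℂ) = (NumberField.ComplexEmbedding.conjugate σ : K → ℂ) := by
  funext a
  rw [conjChar, NumberField.ComplexEmbedding.conjugate_coe_eq]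

/-- `conjAct` carries the `σ`-eigenspace of the `K`-action onto the `σ̄`-eigenspace:
the `σ̄`-eigenline is the complex conjugate of the `σ`-eigenline. -/
theorem conjAct_image_jointEigenspace_embedding (T : K → V →ₗ[ℚ] V) (σ : K →+* ℂ) :
    conjAct '' (jointEigenspace T σ : Set (ℂ ⊗[ℚ] V)) =
      jointEigenspace T (NumberField.ComplexEmbedding.conjugate σ) := by
  rw [conjAct_image_jointEigenspace, conjChar_embedding]

/-- The `σ`- and `σ̄`-eigenspaces of the `K`-action have the same `ℂ`-dimension. -/
theorem finrank_jointEigenspace_embedding_conj (T : K → V →ₗ[ℚ] V) (σ : K →+* ℂ) :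
    Module.finrank ℂ (jointEigenspace T (NumberField.ComplexEmbedding.conjugate σ)) =
      Module.finrank ℂ (jointEigenspace T σ) := by
  rw [← conjChar_embedding, finrank_jointEigenspace_conj]

end CMField

end Summit.Ventures.HodgeRepro2.T5ConjugateEigenlines
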